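import Mathlib.Analysis.Calculus.SmoothSeries
import Literature.NumberTheory.LFunctions.DirichletLOneTail
import HarnessLib

/-!
# The derivative of a Dirichlet `L`-function on `Re s > 0` by Abel summation:
# `L'(s, χ) = ∑_{n ≥ 1} S(n) d/ds (n^{-s} − (n+1)^{-s})`

Topic `Literature/NumberTheory/LFunctions`. Everything in this file is PROVED (theorems only, no
new definitions: the derivative of the `n`-th Abel term is referred to as
`deriv (DirichletAbel.term χ n) s`).

For a non-principal character `χ` mod `q` the tree's
`Literature.NumberTheory.LFunctions.DirichletAbel.LFunction_eq_abelSum` expresses `L(s, χ)` on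
`Re s > 0` as the locally uniformly convergent series `∑_n S(n+1)((n+1)^{-s} − (n+2)^{-s})`
(Montgomery–Vaughan Thm. 1.3 / Thm. 4.8). Here we differentiate it termwise:

* `hasDerivAt_term`, `deriv_term` — `d/ds [S(n+1)((n+1)^{-s} − (n+2)^{-s})]
   = S(n+1)(−(n+1)^{-s} log(n+1) + (n+2)^{-s} log(n+2))`;
* `norm_deriv_term_le` — the mean-value bound
  `‖·‖ ≤ ‖S(n+1)‖ (1 + ‖s‖ log(n+2)) (n+1)^{−Re s − 1}`;
* `hasDerivAt_abelSum` — `A_χ'(s) = ∑_n d/ds term_n(s)` for `Re s > 0`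
  (Mathlib's `hasDerivAt_tsum_of_isPreconnected` on `{σ₀ < Re s, ‖s‖ < R}`);
* `deriv_LFunction_eq_tsum` — `L'(s, χ) = ∑_n deriv term_n (s)` for `Re s > 0`, `χ ≠ χ₀`, in
  particular at `s = 1` (the input of Montgomery–Vaughan's Exercise 11.2.3(b),
  `∑_{n ≤ y} χ(n) log n/n = −L'(1, χ) + O(q^{1/2} y^{−1}(log qy)²)`, proved in
  `DirichletLOneDerivTail.lean`).

## References

* H. L. Montgomery, R. C. Vaughan, *Multiplicative Number Theory I*, CUP 2007, §1.3 Thm. 1.3,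
  §4.3 Thm. 4.8 and (4.33) (`∑_{n ≤ x} χ(n) log n/n = −L'(1, χ) + O_q(log x/x)`), §11.2.1
  Exercise 3(b). [cite: MontgomeryVaughan2007, §4.3 Thm. 4.8 and eq. (4.33)]
-/

noncomputable section

open Complex Filter Topology Finset

namespace Literature.NumberTheory.LFunctions.DirichletAbel

variable {q : ℕ} [NeZero q] (χ : DirichletCharacter ℂ q)

/-! ### The derivative of one Abel term -/

omit [NeZero q] in
/-- `d/ds [S(n+1)((n+1)^{-s} − (n+2)^{-s})] = S(n+1)(−(n+1)^{-s} log(n+1) + (n+2)^{-s} log(n+2))`.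
[folklore] -/
theorem hasDerivAt_term (n : ℕ) (s : ℂ) :
    HasDerivAt (term χ n) (partialSum χ (n + 1) *
      (-(((n + 1 : ℕ) : ℂ) ^ (-s) * Complex.log ((n + 1 : ℕ) : ℂ)) +
        ((n + 1 + 1 : ℕ) : ℂ) ^ (-s) * Complex.log ((n + 1 + 1 : ℕ) : ℂ))) s := by
  have ha := (hasDerivAt_neg s).const_cpow (c := ((n + 1 : ℕ) : ℂ))
    (Or.inl (by exact_mod_cast Nat.succ_ne_zero n))
  have hb := (hasDerivAt_neg s).const_cpow (c := ((n + 1 + 1 : ℕ) : ℂ))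
    (Or.inl (by exact_mod_cast Nat.succ_ne_zero (n + 1)))
  have h := (ha.sub hb).const_mul (partialSum χ (n + 1))
  unfold term
  exact h.congr_deriv (by ring)

omit [NeZero q] in
/-- The formula for `deriv (term χ n) s`. [folklore] -/
theorem deriv_term (n : ℕ) (s : ℂ) :
    deriv (term χ n) s = partialSum χ (n + 1) *
      (-(((n + 1 : ℕ) : ℂ) ^ (-s) * Complex.log ((n + 1 : ℕ) : ℂ)) +
        ((n + 1 + 1 : ℕ) : ℂ) ^ (-s) * Complex.log ((n + 1 + 1 : ℕ) : ℂ)) :=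
  (hasDerivAt_term χ n s).deriv

/-- The mean-value bound `‖−a^{-s} log a + (a+1)^{-s} log(a+1)‖ ≤ (1 + ‖s‖ log(a+1)) a^{−Re s − 1}`
for real `a ≥ 1` and `Re s > 0` (derivative of `w ↦ w^{-s} log w` is `w^{-s-1}(1 − s log w)`).
[folklore] -/
theorem norm_cpow_neg_mul_log_sub_le {a : ℝ} (ha : 1 ≤ a) {s : ℂ} (hs : 0 < s.re) :
    ‖-((a : ℂ) ^ (-s) * (Real.log a : ℂ)) + ((a + 1 : ℝ) : ℂ) ^ (-s) * (Real.log (a + 1) : ℂ)‖ ≤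
      (1 + ‖s‖ * Real.log (a + 1)) * a ^ (-s.re - 1) := by
  have ha0 : 0 < a := by linarith
  have hs0 : -s ≠ 0 := neg_ne_zero.mpr fun h => by simp [h] at hs
  set C : ℝ := (1 + ‖s‖ * Real.log (a + 1)) * a ^ (-s.re - 1) with hC
  have key := norm_image_sub_le_of_norm_deriv_le_segment'
    (f := fun w : ℝ => (w : ℂ) ^ (-s) * (Real.log w : ℂ))
    (f' := fun w : ℝ => -s * (w : ℂ) ^ (-s - 1) * (Real.log w : ℂ) + (w : ℂ) ^ (-s) * ((w⁻¹ : ℝ) : ℂ))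
    (a := a) (b := a + 1) (C := C) ?_ ?_ (a + 1) ⟨by linarith, le_rfl⟩
  · have e : -((a : ℂ) ^ (-s) * (Real.log a : ℂ)) + ((a + 1 : ℝ) : ℂ) ^ (-s) * (Real.log (a + 1) : ℂ)
        = ((a + 1 : ℝ) : ℂ) ^ (-s) * (Real.log (a + 1) : ℂ) - (a : ℂ) ^ (-s) * (Real.log a : ℂ) := by
      ring
    rw [e]
    simpa using key
  · intro w hw
    have hw0 : 0 < w := by linarith [hw.1]
    exact (((hasDerivAt_ofReal_cpow_const hw0.ne' hs0).mul
      ((Real.hasDerivAt_log hw0.ne').ofReal_comp))).hasDerivWithinAt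
  · intro w hw
    have hw0 : 0 < w := by linarith [hw.1]
    have hw1 : 1 ≤ w := ha.trans hw.1
    have hlogw : 0 ≤ Real.log w := Real.log_nonneg hw1
    have hlogw' : Real.log w ≤ Real.log (a + 1) := Real.log_le_log hw0 hw.2.le
    have hloga : 0 ≤ 1 + ‖s‖ * Real.log (a + 1) :=
      add_nonneg zero_le_one (mul_nonneg (norm_nonneg _) (hlogw.trans hlogw'))
    have hpow : w ^ (-s.re - 1) ≤ a ^ (-s.re - 1) :=
      Real.rpow_le_rpow_of_nonpos ha0 hw.1 (by linarith)
    have hn1 : ‖-s * (w : ℂ) ^ (-s - 1) * (Real.log w : ℂ)‖ = ‖s‖ * w ^ (-s.re - 1) * Real.log w := by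
      rw [norm_mul, norm_mul, norm_neg, Complex.norm_cpow_eq_rpow_re_of_pos hw0, Complex.norm_real,
        Real.norm_eq_abs, abs_of_nonneg hlogw]
      simp
    have hn2 : ‖(w : ℂ) ^ (-s) * ((w⁻¹ : ℝ) : ℂ)‖ = w ^ (-s.re - 1) := by
      rw [norm_mul, Complex.norm_cpow_eq_rpow_re_of_pos hw0, Complex.norm_real, Real.norm_eq_abs,
        abs_of_pos (inv_pos.mpr hw0), neg_re, Real.rpow_sub_one hw0.ne', div_eq_mul_inv]
    calc ‖-s * (w : ℂ) ^ (-s - 1) * (Real.log w : ℂ) + (w : ℂ) ^ (-s) * ((w⁻¹ : ℝ) : ℂ)‖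
        ≤ ‖-s * (w : ℂ) ^ (-s - 1) * (Real.log w : ℂ)‖ + ‖(w : ℂ) ^ (-s) * ((w⁻¹ : ℝ) : ℂ)‖ :=
          norm_add_le _ _
      _ = (1 + ‖s‖ * Real.log w) * w ^ (-s.re - 1) := by rw [hn1, hn2]; ring
      _ ≤ (1 + ‖s‖ * Real.log (a + 1)) * a ^ (-s.re - 1) := by
          apply mul_le_mul _ hpow (by positivity) hloga
          gcongr

omit [NeZero q] in
/-- **Bound for the derivative of an Abel term**:
`‖deriv term_n (s)‖ ≤ ‖S(n+1)‖ (1 + ‖s‖ log(n+2)) (n+1)^{−Re s − 1}` for `Re s > 0`.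
[folklore] -/
theorem norm_deriv_term_le (n : ℕ) {s : ℂ} (hs : 0 < s.re) :
    ‖deriv (term χ n) s‖ ≤ ‖partialSum χ (n + 1)‖ *
      ((1 + ‖s‖ * Real.log ((n : ℝ) + 2)) * ((n : ℝ) + 1) ^ (-s.re - 1)) := by
  rw [deriv_term, norm_mul]
  refine mul_le_mul_of_nonneg_left ?_ (norm_nonneg _)
  have h := norm_cpow_neg_mul_log_sub_le (a := (n : ℝ) + 1) (by linarith [n.cast_nonneg (α := ℝ)]) hs
  have e1 : ((n + 1 : ℕ) : ℂ) = (((n : ℝ) + 1 : ℝ) : ℂ) := by push_cast; ring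
  have e2 : ((n + 1 + 1 : ℕ) : ℂ) = (((n : ℝ) + 1 + 1 : ℝ) : ℂ) := by push_cast; ring
  have l1 : Complex.log ((n + 1 : ℕ) : ℂ) = (Real.log ((n : ℝ) + 1) : ℂ) := by
    rw [← Complex.natCast_log]; push_cast; ring_nf
  have l2 : Complex.log ((n + 1 + 1 : ℕ) : ℂ) = (Real.log ((n : ℝ) + 1 + 1) : ℂ) := by
    rw [← Complex.natCast_log]; push_cast; ring_nf
  rw [l1, l2, e1, e2]
  refine h.trans (le_of_eq ?_)
  ring_nf

/-! ### Termwise differentiation of the Abel series -/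

/-- A summable majorant for the derivatives on `{σ₀ < Re s, ‖s‖ < R}`: the sequence
`(1 + R log(n+2)) (n+1)^{−σ₀−1}` is summable for `σ₀ > 0` (`log(n+2) ≤ (n+2)^{σ₀/2}/(σ₀/2)`).
[folklore] -/
theorem summable_log_mul_rpow {σ₀ R : ℝ} (hσ₀ : 0 < σ₀) (hR : 0 ≤ R) :
    Summable fun n : ℕ => (1 + R * Real.log ((n : ℝ) + 2)) * ((n : ℝ) + 1) ^ (-σ₀ - 1) := by
  have hε : 0 < σ₀ / 2 := half_pos hσ₀
  set K : ℝ := (2 : ℝ) ^ (σ₀ / 2) / (σ₀ / 2) with hK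
  have hK0 : 0 ≤ K := by positivity
  -- majorant: `(1 + R K) (n+1)^{-σ₀/2 - 1}`
  have hmaj : Summable fun n : ℕ => (1 + R * K) * ((n : ℝ) + 1) ^ (-(σ₀ / 2) - 1) := by
    have := (summable_rpow_neg hε).mul_left (1 + R * K)
    refine this.congr fun n => ?_
    push_cast; ring_nf
  refine Summable.of_nonneg_of_le (fun n => ?_) (fun n => ?_) hmaj
  · have : 0 ≤ Real.log ((n : ℝ) + 2) := Real.log_nonneg (by linarith [n.cast_nonneg (α := ℝ)])
    positivity
  · have hn1 : (1 : ℝ) ≤ (n : ℝ) + 1 := by linarith [n.cast_nonneg (α := ℝ)]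
    have hn0 : (0 : ℝ) < (n : ℝ) + 1 := by linarith
    have hlog : Real.log ((n : ℝ) + 2) ≤ K * ((n : ℝ) + 1) ^ (σ₀ / 2) := by
      have h1 := Real.log_le_rpow_div (x := (n : ℝ) + 2) (by linarith) hε
      have h2 : ((n : ℝ) + 2) ^ (σ₀ / 2) ≤ (2 * ((n : ℝ) + 1)) ^ (σ₀ / 2) :=
        Real.rpow_le_rpow (by linarith) (by linarith) hε.le
      rw [Real.mul_rpow (by norm_num) hn0.le] at h2
      calc Real.log ((n : ℝ) + 2) ≤ ((n : ℝ) + 2) ^ (σ₀ / 2) / (σ₀ / 2) := h1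
        _ ≤ (2 : ℝ) ^ (σ₀ / 2) * ((n : ℝ) + 1) ^ (σ₀ / 2) / (σ₀ / 2) := by gcongr
        _ = K * ((n : ℝ) + 1) ^ (σ₀ / 2) := by rw [hK]; ring
    have hsplit : ((n : ℝ) + 1) ^ (-(σ₀ / 2) - 1) = ((n : ℝ) + 1) ^ (σ₀ / 2) * ((n : ℝ) + 1) ^ (-σ₀ - 1) := by
      rw [← Real.rpow_add hn0]; ring_nf
    have hone : (1 : ℝ) ≤ ((n : ℝ) + 1) ^ (σ₀ / 2) := Real.one_le_rpow hn1 hε.le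
    have hp0 : 0 ≤ ((n : ℝ) + 1) ^ (-σ₀ - 1) := Real.rpow_nonneg hn0.le _
    rw [hsplit]
    calc (1 + R * Real.log ((n : ℝ) + 2)) * ((n : ℝ) + 1) ^ (-σ₀ - 1)
        ≤ (1 * ((n : ℝ) + 1) ^ (σ₀ / 2) + R * (K * ((n : ℝ) + 1) ^ (σ₀ / 2))) *
            ((n : ℝ) + 1) ^ (-σ₀ - 1) := by
          apply mul_le_mul_of_nonneg_right _ hp0
          gcongr
          simpa using hone
      _ = (1 + R * K) * (((n : ℝ) + 1) ^ (σ₀ / 2) * ((n : ℝ) + 1) ^ (-σ₀ - 1)) := by ring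

/-- **The Abel series may be differentiated termwise on `Re s > 0`** (`χ ≠ χ₀`):
`A_χ'(s) = ∑_n d/ds [S(n+1)((n+1)^{-s} − (n+2)^{-s})]`, by Mathlib's
`hasDerivAt_tsum_of_isPreconnected` on the convex open set `{σ₀ < Re w, ‖w‖ < R}` with the
majorant `q (1 + R log(n+2)) (n+1)^{−σ₀−1}`. [cite: MontgomeryVaughan2007, §4.3 Thm. 4.8] -/
theorem hasDerivAt_abelSum (hχ : χ ≠ 1) {s : ℂ} (hs : 0 < s.re) :
    HasDerivAt (abelSum χ) (∑' n : ℕ, deriv (term χ n) s) s := by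
  set σ₀ : ℝ := s.re / 2 with hσ₀
  have hσ₀0 : 0 < σ₀ := by rw [hσ₀]; linarith
  set R : ℝ := ‖s‖ + 1 with hR
  have hR0 : 0 ≤ R := by positivity
  set U : Set ℂ := {w : ℂ | σ₀ < w.re} ∩ Metric.ball (0 : ℂ) R with hU
  have hUo : IsOpen U := (isOpen_lt continuous_const Complex.continuous_re).inter Metric.isOpen_ball
  have hUc : IsPreconnected U :=
    ((convex_halfSpace_re_gt σ₀).inter (convex_ball (0 : ℂ) R)).isPreconnected
  have hsU : s ∈ U :=
    ⟨by simp only [Set.mem_setOf_eq, hσ₀]; linarith, by rw [mem_ball_zero_iff, hR]; linarith⟩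
  have key := hasDerivAt_tsum_of_isPreconnected
    (u := fun n : ℕ => (q : ℝ) * ((1 + R * Real.log ((n : ℝ) + 2)) * ((n : ℝ) + 1) ^ (-σ₀ - 1)))
    (g := fun n w => term χ n w) (g' := fun n w => deriv (term χ n) w) (t := U) (y₀ := s) (y := s)
    ((summable_log_mul_rpow hσ₀0 hR0).mul_left _) hUo hUc
    (fun n w _ => (hasDerivAt_term χ n w).differentiableAt.hasDerivAt) ?_ hsU
    (summable_term χ hχ hs) hsU
  · exact key
  · intro n w hw
    obtain ⟨hw1, hw2⟩ := hw
    simp only [Set.mem_setOf_eq] at hw1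
    rw [mem_ball_zero_iff] at hw2
    have hw0 : 0 < w.re := lt_trans hσ₀0 hw1
    refine (norm_deriv_term_le χ n hw0).trans ?_
    have hn0 : (0 : ℝ) < (n : ℝ) + 1 := by linarith [n.cast_nonneg (α := ℝ)]
    have hn1 : (1 : ℝ) ≤ (n : ℝ) + 1 := by linarith [n.cast_nonneg (α := ℝ)]
    have hlog : 0 ≤ Real.log ((n : ℝ) + 2) := Real.log_nonneg (by linarith [n.cast_nonneg (α := ℝ)])
    have hpow : ((n : ℝ) + 1) ^ (-w.re - 1) ≤ ((n : ℝ) + 1) ^ (-σ₀ - 1) :=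
      Real.rpow_le_rpow_of_exponent_le hn1 (by linarith)
    have hS : ‖partialSum χ (n + 1)‖ ≤ q := norm_partialSum_le χ hχ (n + 1)
    calc ‖partialSum χ (n + 1)‖ * ((1 + ‖w‖ * Real.log ((n : ℝ) + 2)) * ((n : ℝ) + 1) ^ (-w.re - 1))
        ≤ (q : ℝ) * ((1 + R * Real.log ((n : ℝ) + 2)) * ((n : ℝ) + 1) ^ (-σ₀ - 1)) := by
          apply mul_le_mul hS _ (by positivity) (by positivity)
          apply mul_le_mul _ hpow (by positivity) (by positivity)
          gcongr

/-- Summability of the derivative series for `Re s > 0`, `χ ≠ χ₀`. [folklore] -/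
theorem summable_deriv_term (hχ : χ ≠ 1) {s : ℂ} (hs : 0 < s.re) :
    Summable fun n : ℕ => deriv (term χ n) s := by
  refine Summable.of_norm_bounded
    (g := fun n : ℕ => (q : ℝ) * ((1 + ‖s‖ * Real.log ((n : ℝ) + 2)) * ((n : ℝ) + 1) ^ (-s.re - 1)))
    ((summable_log_mul_rpow hs (norm_nonneg s)).mul_left _) fun n => ?_
  refine (norm_deriv_term_le χ n hs).trans ?_
  have hlog : 0 ≤ Real.log ((n : ℝ) + 2) := Real.log_nonneg (by linarith [n.cast_nonneg (α := ℝ)])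
  exact mul_le_mul_of_nonneg_right (norm_partialSum_le χ hχ (n + 1)) (by positivity)

/-- **`L'(s, χ) = ∑_n deriv term_n (s)` for `Re s > 0` and `χ ≠ χ₀`**: `L(·, χ)` and the Abel
series agree on the open half-plane `Re s > 0` (`LFunction_eq_abelSum`), so their derivatives
agree there. [cite: MontgomeryVaughan2007, §4.3 Thm. 4.8] -/
theorem deriv_LFunction_eq_tsum (hχ : χ ≠ 1) {s : ℂ} (hs : 0 < s.re) :
    deriv χ.LFunction s = ∑' n : ℕ, deriv (term χ n) s := by
  have heq : χ.LFunction =ᶠ[𝓝 s] abelSum χ := by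
    filter_upwards [isOpen_re_pos.mem_nhds hs] with w hw
    exact LFunction_eq_abelSum χ hχ hw
  rw [heq.deriv_eq]
  exact (hasDerivAt_abelSum χ hχ hs).deriv

/-- `L'(1, χ) = ∑_n S(n+1)(−log(n+1)/(n+1) + log(n+2)/(n+2))`-series form at `s = 1`.
[cite: MontgomeryVaughan2007, §4.3 eq. (4.33)] -/
theorem deriv_LFunction_one_eq_tsum (hχ : χ ≠ 1) :
    deriv χ.LFunction 1 = ∑' n : ℕ, deriv (term χ n) 1 :=
  deriv_LFunction_eq_tsum χ hχ (by simp)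

end Literature.NumberTheory.LFunctions.DirichletAbel
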